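import Summits.BirchSwinnertonDyer.BirchSwinnertonDyer.Theorems.Rank2ObservatoryRank3PSatWitM
import HarnessLib

/-!
# BirchSwinnertonDyer — rank ≥ 2 observatory: rank-3 `p`-saturation certificates, MATRIX form — rows

HONEST FRAMING: per-curve certified theorems and census instruments; no claim on BSD in rank ≥ 2.

KS4 (cert-2; designed g37, landed g38). Part 2: the ROW certificate `Rank3PSatCertM` (scale, scaled integral
generators, kernel point counts `S`, annihilator `t` — as in the class form
`Rank3PSatCertC/CL/CLT` —
plus three witness primes `PSatWitM` of `Rank2ObservatoryRank3PSatWitM.lean` with `p ∤ det (dᵢⱼ)`),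
the row Boolean `rank3PSatCheckM` and its soundness `Rank3Row.pSaturated_of_pSatCheckM` (same
conclusion shape as the class form: `p • a ∈ Λ ⊔ tors → a ∈ Λ ⊔ tors`), the list form
`rank3PSatCheckMAll` / `Rank3Row.pSaturated_of_pSatCheckMAll`, and the SELECTION form for sparse
rows with several primes per row (KS4): `rank3PSatCheckMSel rows [(i, B, [(p, c), …]), …]` — which
also checks that every prime `7 < p ≤ B` is listed — with soundness
`Rank3Row.pSaturated_of_pSatCheckMSel[_idx]`: for every `(i, B)` the row `rows[i]` exists and its
listed span is `p`-saturated for every prime `7 < p ≤ B`.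

Kernel cost per (row, p): three killers (order certificates: `O(log N)` curve operations each) +
`3 × (log₂ p + 3·(log₂ k + log₂ p))` chain steps + one `3 × 3` determinant — versus
`(p² + p + 1) × (log₂ k + 3)` chain steps in the class form (measured, cert-2 g37: ≈ 0.5–1 s per
(row, p) independent of `p`; class form 3.8 s at `p = 7`, `∝ p²`).

Sorry-free; no `decide` is executed in this file (the Booleans are for data files).

References: S. Siksek, Rocky Mountain J. Math. 25 (1995) §3; M. Prickett, *Saturation of
Mordell–Weil groups of elliptic curves over number fields*, PhD thesis, Nottingham (2004);
J. E. Cremona, *Algorithms for Modular Elliptic Curves* (2nd ed. 1997) §3.5;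
J. H. Silverman, AEC (2009) III.2.3, VII.3.
-/

-- single-conjunct summit: `Summit.BirchSwinnertonDyer.BirchSwinnertonDyer.…` repeats the name
set_option linter.dupNamespace false

namespace Summit.BirchSwinnertonDyer.BirchSwinnertonDyer.Rank2Observatory

open WeierstrassCurve

/-! ### The row certificate, matrix form -/

section Row

/-- The MATRIX `p`-SATURATION CERTIFICATE of a rank-3 row: scale `d`, the integral points
`(Xᵢ, Yᵢ)` on `scaleModel _ d`, kernel counts `S` + torsion annihilator `t`, and three witness
primes `w₁ w₂ w₃`. [cite: CremonaAlgorithms1997, §3.5] -/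
structure Rank3PSatCertM where
  /-- scale of the integral model -/
  d : ℤ
  /-- `x`-coordinate of the first scaled generator -/
  X₁ : ℤ
  /-- `y`-coordinate of the first scaled generator -/
  Y₁ : ℤ
  /-- `x`-coordinate of the second scaled generator -/
  X₂ : ℤ
  /-- `y`-coordinate of the second scaled generator -/
  Y₂ : ℤ
  /-- `x`-coordinate of the third scaled generator -/
  X₃ : ℤ
  /-- `y`-coordinate of the third scaled generator -/
  Y₃ : ℤ
  /-- kernel point counts `(ℓ, #Ẽ(𝔽_ℓ))` for the torsion annihilator -/
  S : List (ℕ × ℕ)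
  /-- torsion annihilator -/
  t : ℕ
  /-- first witness prime -/
  w₁ : PSatWitM
  /-- second witness prime -/
  w₂ : PSatWitM
  /-- third witness prime -/
  w₃ : PSatWitM

/-- **The row Boolean, matrix form** (kernel `decide`): base checks as `rank3PSatCheckC`, the
annihilator with shallow killers, the three witness primes (killer + witness Boolean each), and
`p ∤ det (dᵢⱼ)`. [cite: CremonaAlgorithms1997, §3.5] -/
def rank3PSatCheckM (r : Rank3Row) (p : ℕ) (c : Rank3PSatCertM) : Bool :=
  let V := scaleModel r.intModel c.d
  decide (c.d ≠ 0 ∧ V.Δ ≠ 0 ∧ p.Prime ∧ ¬ (p : ℤ) ∣ (c.t : ℤ) ∧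
      c.X₁ * r.P₁.2.2 = c.d ^ 2 * r.P₁.1 ∧ c.Y₁ * r.P₁.2.2 = c.d ^ 3 * r.P₁.2.1 ∧
      c.X₂ * r.P₂.2.2 = c.d ^ 2 * r.P₂.1 ∧ c.Y₂ * r.P₂.2.2 = c.d ^ 3 * r.P₂.2.1 ∧
      c.X₃ * r.P₃.2.2 = c.d ^ 2 * r.P₃.1 ∧ c.Y₃ * r.P₃.2.2 = c.d ^ 3 * r.P₃.2.1 ∧
      c.Y₁ ^ 2 + V.a₁ * c.X₁ * c.Y₁ + V.a₃ * c.Y₁ =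
        c.X₁ ^ 3 + V.a₂ * c.X₁ ^ 2 + V.a₄ * c.X₁ + V.a₆ ∧
      c.Y₂ ^ 2 + V.a₁ * c.X₂ * c.Y₂ + V.a₃ * c.Y₂ =
        c.X₂ ^ 3 + V.a₂ * c.X₂ ^ 2 + V.a₄ * c.X₂ + V.a₆ ∧
      c.Y₃ ^ 2 + V.a₁ * c.X₃ * c.Y₃ + V.a₃ * c.Y₃ =
        c.X₃ ^ 3 + V.a₂ * c.X₃ ^ 2 + V.a₄ * c.X₃ + V.a₆) &&
  annihilatorCheck c.S c.t && c.S.all (killerLTB V) &&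
  c.w₁.killer V && c.w₂.killer V && c.w₃.killer V &&
  pWitnessMB V p c.X₁ c.Y₁ c.X₂ c.Y₂ c.X₃ c.Y₃ c.w₁ &&
  pWitnessMB V p c.X₁ c.Y₁ c.X₂ c.Y₂ c.X₃ c.Y₃ c.w₂ &&
  pWitnessMB V p c.X₁ c.Y₁ c.X₂ c.Y₂ c.X₃ c.Y₃ c.w₃ &&
  decide (¬ (p : ℤ) ∣ det3 c.w₁.d₁ c.w₂.d₁ c.w₃.d₁ c.w₁.d₂ c.w₂.d₂ c.w₃.d₂ c.w₁.d₃ c.w₂.d₃ c.w₃.d₃)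

/-- **SOUNDNESS of the matrix row certificate**: the listed span `ℤP₁ + ℤP₂ + ℤP₃ + E(ℚ)_tors`
is `p`-SATURATED in `E(ℚ) = r.curve⟮ℚ⟯`. [cite: CremonaAlgorithms1997, §3.5]
[cite: SilvermanAEC2009, III.3.1(b)] -/
theorem Rank3Row.pSaturated_of_pSatCheckM (r : Rank3Row) (h : r.check = true) (p : ℕ)
    (c : Rank3PSatCertM) (hc : rank3PSatCheckM r p c = true) :
    ∀ a : r.curve.toAffine.Point,
      p • a ∈ AddSubgroup.closure {r.gen₁ h, r.gen₂ h, r.gen₃ h} ⊔ AddCommGroup.torsion _ →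
        a ∈ AddSubgroup.closure {r.gen₁ h, r.gen₂ h, r.gen₃ h} ⊔ AddCommGroup.torsion _ := by
  unfold rank3PSatCheckM at hc
  simp only [Bool.and_eq_true, decide_eq_true_eq] at hc
  obtain ⟨⟨⟨⟨⟨⟨⟨⟨⟨⟨hd, hΔ, hp, hpt, hX₁, hY₁, hX₂, hY₂, hX₃, hY₃, e₁, e₂, e₃⟩, hann⟩, hS⟩,
    hk₁⟩, hk₂⟩, hk₃⟩, hw₁⟩, hw₂⟩, hw₃⟩, hdet⟩ := hc
  exact r.pSaturated_of_scaled h hd hX₁ hY₁ hX₂ hY₂ hX₃ hY₃ hΔ e₁ e₂ e₃ p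
    (pSaturated_of_certPM _ hΔ e₁ e₂ e₃ hp
      (killers_of_all_killerB _
        (all_killerB_of_all_killerLB _ (all_killerLB_of_all_killerLTB _ hS)))
      hann hpt (c.w₁.killerB_of_killer _ hk₁) (c.w₂.killerB_of_killer _ hk₂)
      (c.w₃.killerB_of_killer _ hk₃) hw₁ hw₂ hw₃ hdet)

/-- The matrix Boolean over a list of rows and certificates (same order). [folklore] -/
def rank3PSatCheckMAll (p : ℕ) : List Rank3Row → List Rank3PSatCertM → Bool
  | [], _ => true
  | _ :: _, [] => false
  | r :: rs, c :: cs => rank3PSatCheckM r p c && rank3PSatCheckMAll p rs cs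

/-- **Soundness of the list form, matrix certificates.** [cite: CremonaAlgorithms1997, §3.5] -/
theorem Rank3Row.pSaturated_of_pSatCheckMAll (p : ℕ) :
    ∀ {rows : List Rank3Row} {cs : List Rank3PSatCertM}, rank3PSatCheckMAll p rows cs = true →
      ∀ r ∈ rows, ∀ h : r.check = true, ∀ a : r.curve.toAffine.Point,
        p • a ∈ AddSubgroup.closure {r.gen₁ h, r.gen₂ h, r.gen₃ h} ⊔ AddCommGroup.torsion _ →
          a ∈ AddSubgroup.closure {r.gen₁ h, r.gen₂ h, r.gen₃ h} ⊔ AddCommGroup.torsion _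
  | [], _, _ => by simp
  | _ :: _, [], hc => by simp [rank3PSatCheckMAll] at hc
  | r :: rs, c :: cs, hc => by
    rw [rank3PSatCheckMAll, Bool.and_eq_true] at hc
    intro r' hr'
    rcases List.mem_cons.mp hr' with rfl | hmem
    · exact fun h => r'.pSaturated_of_pSatCheckM h p c hc.1
    · exact Rank3Row.pSaturated_of_pSatCheckMAll p hc.2 r' hmem

/-! ### Selection form (KS4: sparse rows, several primes per row)

An entry `(i, B, [(p, c), …])` names row `rows[i]`, a bound `B` and one matrix certificate per
listed
prime; the Boolean also checks that EVERY prime `7 < p ≤ B` is listed, so that soundness reads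
"for every prime `7 < p ≤ B` the listed span is `p`-saturated" for that row. -/

/-- Selection-form Boolean. -/
def rank3PSatCheckMSel (rows : List Rank3Row) (sel : List (ℕ × ℕ × List (ℕ × Rank3PSatCertM))) :
    Bool :=
  sel.all fun e =>
    decide (∀ p < e.2.1 + 1, p.Prime → 7 < p → p ∈ e.2.2.map Prod.fst) &&
    match rows[e.1]? with
    | none => false
    | some r => e.2.2.all fun pc => rank3PSatCheckM r pc.1 pc.2

/-- **Soundness of the selection form**: for every entry `(i, B, pcs)` the row `rows[i]` exists and
its listed span `ℤP₁ + ℤP₂ + ℤP₃ + E(ℚ)_tors` is `p`-saturated in `E(ℚ)` for every prime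
`7 < p ≤ B`. [cite: CremonaAlgorithms1997, §3.5] -/
theorem Rank3Row.pSaturated_of_pSatCheckMSel {rows : List Rank3Row}
    {sel : List (ℕ × ℕ × List (ℕ × Rank3PSatCertM))} (hsel : rank3PSatCheckMSel rows sel = true) :
    ∀ e ∈ sel, ∃ r, rows[e.1]? = some r ∧ ∀ p, p.Prime → 7 < p → p ≤ e.2.1 →
      ∀ h : r.check = true, ∀ a : r.curve.toAffine.Point,
        p • a ∈ AddSubgroup.closure {r.gen₁ h, r.gen₂ h, r.gen₃ h} ⊔ AddCommGroup.torsion _ →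
          a ∈ AddSubgroup.closure {r.gen₁ h, r.gen₂ h, r.gen₃ h} ⊔ AddCommGroup.torsion _ := by
  intro e he
  have h1 := List.all_eq_true.mp hsel e he
  rw [Bool.and_eq_true, decide_eq_true_eq] at h1
  obtain ⟨hcov, h2⟩ := h1
  cases hr : rows[e.1]? with
  | none => simp [hr] at h2
  | some r =>
    simp only [hr] at h2
    refine ⟨r, rfl, fun p hp h7 hpB h => ?_⟩
    obtain ⟨pc, hpc, hpc1⟩ := List.mem_map.mp (hcov p (Nat.lt_succ_of_le hpB) hp h7)
    subst hpc1
    exact r.pSaturated_of_pSatCheckM h pc.1 pc.2 (List.all_eq_true.mp h2 pc hpc)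

/-- **Soundness of the selection form, position/bound index**: the statement a data file exports —
for every `(i, B)` of the index list the row `rows[i]` exists and its listed span is `p`-saturated
for every prime `7 < p ≤ B`. [cite: CremonaAlgorithms1997, §3.5] -/
theorem Rank3Row.pSaturated_of_pSatCheckMSel_idx {rows : List Rank3Row}
    {sel : List (ℕ × ℕ × List (ℕ × Rank3PSatCertM))} {idx : List (ℕ × ℕ)}
    (hidx : sel.map (fun e => (e.1, e.2.1)) = idx) (hsel : rank3PSatCheckMSel rows sel = true) :
    ∀ e ∈ idx, ∃ r, rows[e.1]? = some r ∧ ∀ p, p.Prime → 7 < p → p ≤ e.2 →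
      ∀ h : r.check = true, ∀ a : r.curve.toAffine.Point,
        p • a ∈ AddSubgroup.closure {r.gen₁ h, r.gen₂ h, r.gen₃ h} ⊔ AddCommGroup.torsion _ →
          a ∈ AddSubgroup.closure {r.gen₁ h, r.gen₂ h, r.gen₃ h} ⊔ AddCommGroup.torsion _ := by
  subst hidx
  intro e he
  obtain ⟨e', he', rfl⟩ := List.mem_map.mp he
  exact Rank3Row.pSaturated_of_pSatCheckMSel hsel e' he'

end Row

end Summit.BirchSwinnertonDyer.BirchSwinnertonDyer.Rank2Observatory
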